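import Literature.AlgebraicGeometry.HodgeTheory.FermatHodgeCharacterCriterion
import HarnessLib

/-!
# The Hodge condition at a conductor `f` prime to `6`, met at the exact levels `f`, `2f`, `3f`, `6f` — Aoki 1983, Prop. 2.2

Topic `Literature/AlgebraicGeometry/HodgeTheory`. THEOREMS only (no definition, no named fact, no `sorry`).
Support file (XXV), the common refinement of `FermatHodgeCharacterExactLevel` (XVIII: levels `f`, `2f`),
`FermatHodgeCharacterThirdConductor` (XXIII: levels `f`, `3f`) and `FermatHodgeCharacterOddConductor` (XXI):
here the conductor `f` is prime to `6` and the levels meeting it are among `f`, `2f`, `3f`, `6f`; the level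
`6f` carries the Euler factor `(1 - χ(2))(1 - χ(3))`, the level `3f` the factor `1 - χ(3)`, the level `2f`
the factor `1 - χ(2)`, and the levels `f`, `2f` have TWICE the weight of `3f`, `6f`
(`φ(2f) = φ(f)`, `φ(3f) = φ(6f) = 2φ(f)`). This is Aoki's "`τ₆(α) ∈ A(m/6)`" ([Aoki1983, Thm. C] §9
(III-12), (III-13) p. 52: "`τ₆(α) = 2(1, -2⁻¹)(1, -3⁻¹, b', c') ∈ A(m/6)`",
"`τ₆(α) = 2{(1, -2⁻¹)(1, -3⁻¹) + (b', c')} ∈ A(m/6)`") and the relation at the conductor `n/3` for the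
levels `m = 2n`, `n` odd, `3 ∥ n` (route K₆ of the cell's scoping document: cases `N = 1, 2, 0`).

For a Hodge character `α : Fin r → ℤ/m`, `αᵢ = (m/Mᵢ) wᵢ` (`Mᵢ ∣ m` the exact level, `wᵢ` a unit mod `Mᵢ`),
`f ∣ m` prime to `6` such that every `Mᵢ` divisible by `f` is one of `f, 2f, 3f, 6f`, and an odd primitive
character `χ` mod `f` — **`IsHodge.rel_sixth_conductor_conj`** —
`∑_{Mᵢ = 6f} (1 - conj χ(2))(1 - conj χ(3)) χ(w̄ᵢ) + ∑_{Mᵢ = 3f} (1 - conj χ(3)) χ(w̄ᵢ)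
  + 2 ∑_{Mᵢ = 2f} (1 - conj χ(2)) χ(w̄ᵢ) + 2 ∑_{Mᵢ = f} χ(w̄ᵢ) = 0` (`w̄ᵢ = wᵢ mod f`).
With `2v₂ = -1`, `3v₃ = -1` the four kinds of points are: quadruples `w̄, v₂w̄, v₃w̄, v₂v₃w̄` (weight 1),
`3`-twins `w̄, v₃w̄` (weight 1), `2`-twins `w̄, v₂w̄` (weight 2), singles (weight 2).
v2 (section `SixthLevel`): **`IsHodge.rel_sixth_level`** — the same relation at a level `m = 6d`, `d` prime
to `6`, as a function of the coordinates `αᵢ` themselves (the exact level of `αᵢ` is read off from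
`IsUnit αᵢ`, `IsUnit (αᵢ mod d)`, `αᵢ mod 2`, `αᵢ mod 3`; `sixth_term`), in the style of `IsHodge.rel_half_level`
(support file `FermatHodgeCharacterSubLevel`): the form used by route K₆ (`m = 2n`, `n` odd, `3 ∥ n`, `d = n/3`).

HONEST FRAMING (cell `pub-hfermat`): explicit algebraic cycles for specific Hodge classes on
Fermat/Delsarte varieties; residual open instances listed; no claim on general Hodge. (Surface
classes are algebraic by Lefschetz (1,1); this file is a relation among Hodge characters, no case
of HC.)

## References
* [Aoki1983] N. Aoki, *On some arithmetic problems related to the Hodge cycles on the Fermat varieties*,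
  Math. Ann. 266 (1983) 23–54 — Props. 2.1, 2.2 (pp. 28–29), §9 (III-12), (III-13) p. 52, (V) pp. 52–54.
-/

noncomputable section

open Finset

namespace Literature.AlgebraicGeometry.HodgeTheory

namespace FermatCharacter

section SixthConductor

variable {m : ℕ}

/-- `χ` vanishes at the primes of its level: `∏_{p ∣ f} (1 - χ(p)) = 1`. [folklore] -/
private theorem prod_primeFactors_one_sub_eq_one₆ {f : ℕ} (χ : DirichletCharacter ℂ f) :
    ∏ p ∈ f.primeFactors, (1 - χ (p : ZMod f)) = 1 := by
  refine Finset.prod_eq_one fun p hp ↦ ?_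
  have hpf : p ∣ f := Nat.dvd_of_mem_primeFactors hp
  have hp1 : p.Prime := Nat.prime_of_mem_primeFactors hp
  have hnu : ¬ IsUnit ((p : ℕ) : ZMod f) := by
    rw [ZMod.isUnit_iff_coprime]
    intro hc
    exact hp1.one_lt.ne' (Nat.Coprime.eq_one_of_dvd hc hpf)
  rw [χ.map_nonunit hnu, sub_zero]

/-- **[Aoki1983, Prop. 2.2] at a conductor `f` prime to `6`, met only at the exact levels `f, 2f, 3f, 6f`.**
Let `α = (α₀, …, α_{r-1})` be a Hodge character of level `m`, `αᵢ = (m/Mᵢ) wᵢ` with `Mᵢ ∣ m` and `wᵢ` a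
unit mod `Mᵢ`, and let `f ∣ m` with `2 ∤ f`, `3 ∤ f` be such that every `Mᵢ` divisible by `f` is `f`, `2f`,
`3f` or `6f`. Then for every odd primitive character `χ` mod `f`:
`∑_{Mᵢ = 6f} (1 - χ(2))(1 - χ(3)) (χ w̄ᵢ)⁻¹ + ∑_{Mᵢ = 3f} (1 - χ(3)) (χ w̄ᵢ)⁻¹
  + 2 ∑_{Mᵢ = 2f} (1 - χ(2)) (χ w̄ᵢ)⁻¹ + 2 ∑_{Mᵢ = f} (χ w̄ᵢ)⁻¹ = 0`
(`w̄ᵢ = wᵢ mod f`; the weights `φ(m)/φ(Mᵢ)` are `c/2, c/2, c, c` for `Mᵢ = 6f, 3f, 2f, f`, `c = φ(m)/φ(f)`).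
[cite: Aoki1983, Prop. 2.2 with Prop. 2.1; §9 (III-12)–(III-13) p. 52] -/
theorem IsHodge.rel_sixth_conductor [NeZero m] {r : ℕ} {α : Fin r → ZMod m} (h : IsHodge α)
    {f : ℕ} [NeZero f] (h2 : ¬ 2 ∣ f) (h3 : ¬ 3 ∣ f) (hfm : f ∣ m) {χ : DirichletCharacter ℂ f}
    (hχ : χ.Odd) (hprim : χ.IsPrimitive) (M : Fin r → ℕ) [∀ i, NeZero (M i)] (hM : ∀ i, M i ∣ m)
    (w : (i : Fin r) → ZMod (M i)) (hw : ∀ i, IsUnit (w i))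
    (hα : ∀ i, α i = ((m / M i : ℕ) : ZMod m) * ((ZMod.val (w i) : ℕ) : ZMod m))
    (hlev : ∀ i, f ∣ M i → M i = f ∨ M i = 2 * f ∨ M i = 3 * f ∨ M i = 6 * f) :
    ∑ i, (if M i = 6 * f then (1 - χ 2) * (1 - χ 3) * (χ (ZMod.cast (w i) : ZMod f))⁻¹
      else if M i = 3 * f then (1 - χ 3) * (χ (ZMod.cast (w i) : ZMod f))⁻¹
      else if M i = 2 * f then 2 * (1 - χ 2) * (χ (ZMod.cast (w i) : ZMod f))⁻¹
      else if M i = f then 2 * (χ (ZMod.cast (w i) : ZMod f))⁻¹ else 0) = 0 := by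
  classical
  have hm0 : m ≠ 0 := NeZero.ne m
  have hf0 : f ≠ 0 := NeZero.ne f
  have key := h.aoki_criterion hfm hχ hprim M hM w hw hα
  have hφf : ((f.totient : ℕ) : ℂ) ≠ 0 := by
    exact_mod_cast (Nat.totient_pos.mpr (Nat.pos_of_ne_zero hf0)).ne'
  set c : ℂ := (m.totient : ℂ) / (f.totient : ℂ) with hc
  have hc0 : c ≠ 0 := div_ne_zero
    (by exact_mod_cast (Nat.totient_pos.mpr (Nat.pos_of_ne_zero hm0)).ne') hφf
  have hne12 : f ≠ 2 * f := by omega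
  have hne13 : f ≠ 3 * f := by omega
  have hne16 : f ≠ 6 * f := by omega
  have hne23 : 2 * f ≠ 3 * f := by omega
  have hne26 : 2 * f ≠ 6 * f := by omega
  have hne36 : 3 * f ≠ 6 * f := by omega
  have hcop2 : Nat.Coprime 2 f := (Nat.Prime.coprime_iff_not_dvd Nat.prime_two).mpr h2
  have hcop3 : Nat.Coprime 3 f := (Nat.Prime.coprime_iff_not_dvd Nat.prime_three).mpr h3
  have hcop6 : Nat.Coprime 6 f := by
    rw [show (6 : ℕ) = 2 * 3 by norm_num]; exact Nat.Coprime.mul_left hcop2 hcop3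
  have h2nmem : (2 : ℕ) ∉ f.primeFactors := fun h ↦ h2 (Nat.dvd_of_mem_primeFactors h)
  have h3nmem : (3 : ℕ) ∉ f.primeFactors := fun h ↦ h3 (Nat.dvd_of_mem_primeFactors h)
  have hpf2 : ∏ p ∈ (2 * f).primeFactors, (1 - χ (p : ZMod f)) = 1 - χ 2 := by
    rw [Nat.primeFactors_mul (by norm_num) hf0, Nat.prime_two.primeFactors,
      show ({2} ∪ f.primeFactors : Finset ℕ) = insert 2 f.primeFactors from rfl,
      Finset.prod_insert h2nmem, prod_primeFactors_one_sub_eq_one₆ χ, mul_one, Nat.cast_ofNat]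
  have hpf3 : ∏ p ∈ (3 * f).primeFactors, (1 - χ (p : ZMod f)) = 1 - χ 3 := by
    rw [Nat.primeFactors_mul (by norm_num) hf0, Nat.prime_three.primeFactors,
      show ({3} ∪ f.primeFactors : Finset ℕ) = insert 3 f.primeFactors from rfl,
      Finset.prod_insert h3nmem, prod_primeFactors_one_sub_eq_one₆ χ, mul_one, Nat.cast_ofNat]
  have hpf6 : ∏ p ∈ (6 * f).primeFactors, (1 - χ (p : ZMod f)) = (1 - χ 2) * (1 - χ 3) := by
    have h3f0 : 3 * f ≠ 0 := by positivity
    have h2nmem' : (2 : ℕ) ∉ (3 * f).primeFactors := by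
      intro h
      have h23 : (2 : ℕ) ∣ 3 * f := Nat.dvd_of_mem_primeFactors h
      exact h2 ((Nat.Coprime.dvd_of_dvd_mul_left (by norm_num : Nat.Coprime 2 3)) h23)
    rw [show 6 * f = 2 * (3 * f) by ring, Nat.primeFactors_mul (by norm_num) h3f0,
      Nat.prime_two.primeFactors,
      show ({2} ∪ (3 * f).primeFactors : Finset ℕ) = insert 2 (3 * f).primeFactors from rfl,
      Finset.prod_insert h2nmem', hpf3, Nat.cast_ofNat]
  have ht2 : ((2 * f).totient : ℂ) = f.totient := by
    rw [Nat.totient_mul hcop2, show Nat.totient 2 = 1 by decide, one_mul]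
  have ht3 : ((3 * f).totient : ℂ) = 2 * f.totient := by
    rw [Nat.totient_mul hcop3, show Nat.totient 3 = 2 by decide]; push_cast; ring
  have ht6 : ((6 * f).totient : ℂ) = 2 * f.totient := by
    rw [Nat.totient_mul hcop6, show Nat.totient 6 = 2 by decide]; push_cast; ring
  have hterm : ∀ i, (if f ∣ M i then ((m.totient : ℂ) / ((M i).totient : ℂ)) *
        (∏ p ∈ (M i).primeFactors, (1 - χ p)) * (χ (ZMod.cast (w i) : ZMod f))⁻¹ else 0) =
      (c / 2) * (if M i = 6 * f then (1 - χ 2) * (1 - χ 3) * (χ (ZMod.cast (w i) : ZMod f))⁻¹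
        else if M i = 3 * f then (1 - χ 3) * (χ (ZMod.cast (w i) : ZMod f))⁻¹
        else if M i = 2 * f then 2 * (1 - χ 2) * (χ (ZMod.cast (w i) : ZMod f))⁻¹
        else if M i = f then 2 * (χ (ZMod.cast (w i) : ZMod f))⁻¹ else 0) := by
    intro i
    by_cases hfi : f ∣ M i
    · rw [if_pos hfi]
      rcases hlev i hfi with h1 | h2' | h3' | h6'
      · -- exact level `f`
        have ht : ((M i).totient : ℂ) = f.totient := by rw [h1]
        have hp : ∏ p ∈ (M i).primeFactors, (1 - χ (p : ZMod f)) = 1 := by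
          rw [h1]; exact prod_primeFactors_one_sub_eq_one₆ χ
        rw [ht, hp, if_neg (by rw [h1]; exact hne16), if_neg (by rw [h1]; exact hne13),
          if_neg (by rw [h1]; exact hne12), if_pos h1, hc]
        ring
      · -- exact level `2f`
        have ht : ((M i).totient : ℂ) = f.totient := by rw [h2']; exact ht2
        have hp : ∏ p ∈ (M i).primeFactors, (1 - χ (p : ZMod f)) = 1 - χ 2 := by
          rw [h2']; exact hpf2
        rw [ht, hp, if_neg (by rw [h2']; exact hne26), if_neg (by rw [h2']; exact hne23), if_pos h2',
          hc]
        ring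
      · -- exact level `3f`
        have ht : ((M i).totient : ℂ) = 2 * f.totient := by rw [h3']; exact ht3
        have hp : ∏ p ∈ (M i).primeFactors, (1 - χ (p : ZMod f)) = 1 - χ 3 := by
          rw [h3']; exact hpf3
        rw [ht, hp, if_neg (by rw [h3']; exact hne36), if_pos h3', hc]
        field_simp
      · -- exact level `6f`
        have ht : ((M i).totient : ℂ) = 2 * f.totient := by rw [h6']; exact ht6
        have hp : ∏ p ∈ (M i).primeFactors, (1 - χ (p : ZMod f)) = (1 - χ 2) * (1 - χ 3) := by
          rw [h6']; exact hpf6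
        rw [ht, hp, if_pos h6', hc]
        field_simp
    · have hne6 : ¬ M i = 6 * f := fun h' ↦ hfi (h' ▸ dvd_mul_left f 6)
      have hne3 : ¬ M i = 3 * f := fun h' ↦ hfi (h' ▸ dvd_mul_left f 3)
      have hne2 : ¬ M i = 2 * f := fun h' ↦ hfi (h' ▸ dvd_mul_left f 2)
      have hne1 : ¬ M i = f := fun h1 ↦ hfi (h1 ▸ dvd_refl f)
      rw [if_neg hfi, if_neg hne6, if_neg hne3, if_neg hne2, if_neg hne1, mul_zero]
  rw [Finset.sum_congr rfl (fun i _ ↦ hterm i), ← Finset.mul_sum] at key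
  exact (mul_eq_zero.mp key).resolve_left (div_ne_zero hc0 two_ne_zero)

/-- **[Aoki1983, Prop. 2.2] at a conductor `f` prime to `6`, met at the exact levels `f, 2f, 3f, 6f` —
with character values.** Under the hypotheses of `IsHodge.rel_sixth_conductor`:
`∑_{Mᵢ = 6f} (1 - conj χ(2))(1 - conj χ(3)) χ(w̄ᵢ) + ∑_{Mᵢ = 3f} (1 - conj χ(3)) χ(w̄ᵢ)
  + 2 ∑_{Mᵢ = 2f} (1 - conj χ(2)) χ(w̄ᵢ) + 2 ∑_{Mᵢ = f} χ(w̄ᵢ) = 0` for every odd primitive `χ` mod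
`f` (complex conjugate of `rel_sixth_conductor`, `|χ(u)| = 1` on units): the points of level `6f` are
quadruples `w̄, v₂w̄, v₃w̄, v₂v₃w̄` (`2v₂ = -1`, `3v₃ = -1`), those of level `3f` are `3`-twins, those of
level `2f` are `2`-twins of weight `2`, those of level `f` single points of weight `2` — Aoki's "`τ₆(α)`".
[cite: Aoki1983, Prop. 2.2; §9 (III-12)–(III-13) p. 52] -/
theorem IsHodge.rel_sixth_conductor_conj [NeZero m] {r : ℕ} {α : Fin r → ZMod m} (h : IsHodge α)
    {f : ℕ} [NeZero f] (h2 : ¬ 2 ∣ f) (h3 : ¬ 3 ∣ f) (hfm : f ∣ m) {χ : DirichletCharacter ℂ f}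
    (hχ : χ.Odd) (hprim : χ.IsPrimitive) (M : Fin r → ℕ) [∀ i, NeZero (M i)] (hM : ∀ i, M i ∣ m)
    (w : (i : Fin r) → ZMod (M i)) (hw : ∀ i, IsUnit (w i))
    (hα : ∀ i, α i = ((m / M i : ℕ) : ZMod m) * ((ZMod.val (w i) : ℕ) : ZMod m))
    (hlev : ∀ i, f ∣ M i → M i = f ∨ M i = 2 * f ∨ M i = 3 * f ∨ M i = 6 * f) :
    ∑ i, (if M i = 6 * f then
        (1 - starRingEnd ℂ (χ 2)) * (1 - starRingEnd ℂ (χ 3)) * χ (ZMod.cast (w i) : ZMod f)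
      else if M i = 3 * f then (1 - starRingEnd ℂ (χ 3)) * χ (ZMod.cast (w i) : ZMod f)
      else if M i = 2 * f then 2 * (1 - starRingEnd ℂ (χ 2)) * χ (ZMod.cast (w i) : ZMod f)
      else if M i = f then 2 * χ (ZMod.cast (w i) : ZMod f) else 0) = 0 := by
  classical
  have key := h.rel_sixth_conductor h2 h3 hfm hχ hprim M hM w hw hα hlev
  -- conjugate: `(χ y)⁻¹ = conj (χ y)`
  have hinv : ∀ y : ZMod f, (χ y)⁻¹ = starRingEnd ℂ (χ y) := by
    intro y
    by_cases hy : IsUnit y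
    · exact Complex.inv_eq_conj (χ.unit_norm_eq_one hy.unit ▸ by rw [IsUnit.unit_spec])
    · rw [χ.map_nonunit hy, inv_zero, map_zero]
  have c2 : starRingEnd ℂ (2 : ℂ) = 2 := map_ofNat _ 2
  have hterm : ∀ i, (if M i = 6 * f then
        (1 - starRingEnd ℂ (χ 2)) * (1 - starRingEnd ℂ (χ 3)) * χ (ZMod.cast (w i) : ZMod f)
      else if M i = 3 * f then (1 - starRingEnd ℂ (χ 3)) * χ (ZMod.cast (w i) : ZMod f)
      else if M i = 2 * f then 2 * (1 - starRingEnd ℂ (χ 2)) * χ (ZMod.cast (w i) : ZMod f)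
      else if M i = f then 2 * χ (ZMod.cast (w i) : ZMod f) else 0) =
      starRingEnd ℂ (if M i = 6 * f then (1 - χ 2) * (1 - χ 3) * (χ (ZMod.cast (w i) : ZMod f))⁻¹
        else if M i = 3 * f then (1 - χ 3) * (χ (ZMod.cast (w i) : ZMod f))⁻¹
        else if M i = 2 * f then 2 * (1 - χ 2) * (χ (ZMod.cast (w i) : ZMod f))⁻¹
        else if M i = f then 2 * (χ (ZMod.cast (w i) : ZMod f))⁻¹ else 0) := by
    intro i
    by_cases h6' : M i = 6 * f
    · rw [if_pos h6', if_pos h6', map_mul, map_mul, map_sub, map_sub, map_one, map_inv₀, ← hinv 2,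
        ← hinv 3, ← hinv (ZMod.cast (w i)), inv_inv]
    · by_cases h3' : M i = 3 * f
      · rw [if_neg h6', if_pos h3', if_neg h6', if_pos h3', map_mul, map_sub, map_one, map_inv₀,
          ← hinv 3, ← hinv (ZMod.cast (w i)), inv_inv]
      · by_cases h2' : M i = 2 * f
        · rw [if_neg h6', if_neg h3', if_pos h2', if_neg h6', if_neg h3', if_pos h2', map_mul, map_mul,
            map_sub, map_one, map_inv₀, c2, ← hinv 2, ← hinv (ZMod.cast (w i)), inv_inv]
        · by_cases h1 : M i = f
          · rw [if_neg h6', if_neg h3', if_neg h2', if_pos h1, if_neg h6', if_neg h3', if_neg h2',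
              if_pos h1, map_mul, map_inv₀, c2, ← hinv, inv_inv]
          · rw [if_neg h6', if_neg h3', if_neg h2', if_neg h1, if_neg h6', if_neg h3', if_neg h2',
              if_neg h1, map_zero]
  rw [Finset.sum_congr rfl fun i _ ↦ hterm i, ← map_sum, key, map_zero]

end SixthConductor

/-! ### The level `m = 6d`, `d` prime to `6`, at the conductor `d` (Aoki's `τ₆(α) ∈ A(m/6)` as a function of `α`) -/

section SixthLevel

variable {d : ℕ} [NeZero d]

omit [NeZero d] in
/-- `6d ≠ 0`. [folklore] -/
private theorem six_mul_ne_zero' (hd0 : d ≠ 0) : 6 * d ≠ 0 := mul_ne_zero (by norm_num) hd0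

/-- The reduction `ℤ/6d → ℤ/k` (`k ∣ 6d`) of `x` is the residue of `⟨x⟩`. [folklore] -/
private theorem castHom_eq_val_cast {k : ℕ} (hk : k ∣ 6 * d) (x : ZMod (6 * d)) :
    ZMod.castHom hk (ZMod k) x = ((x.val : ℕ) : ZMod k) := by
  haveI : NeZero (6 * d) := ⟨six_mul_ne_zero' (NeZero.ne d)⟩
  conv_lhs => rw [← ZMod.natCast_zmod_val x]
  rw [map_natCast]

omit [NeZero d] in
/-- `gcd(⟨x⟩, 6d) = gcd(⟨x⟩, 2) · gcd(⟨x⟩, 3) · gcd(⟨x⟩, d)` for `d` prime to `6`. [folklore] -/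
private theorem gcd_six_mul_eq (hd2 : ¬ 2 ∣ d) (hd3 : ¬ 3 ∣ d) (a : ℕ) :
    (6 * d).gcd a = a.gcd 2 * a.gcd 3 * a.gcd d := by
  have hcop2 : Nat.Coprime 2 d := (Nat.Prime.coprime_iff_not_dvd Nat.prime_two).mpr hd2
  have hcop3 : Nat.Coprime 3 d := (Nat.Prime.coprime_iff_not_dvd Nat.prime_three).mpr hd3
  have hcop6 : Nat.Coprime 6 d := by
    rw [show (6 : ℕ) = 2 * 3 by norm_num]; exact Nat.Coprime.mul_left hcop2 hcop3
  rw [Nat.gcd_comm, Nat.Coprime.gcd_mul a hcop6, show (6 : ℕ) = 2 * 3 by norm_num,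
    Nat.Coprime.gcd_mul a (by norm_num : Nat.Coprime 2 3)]

omit [NeZero d] in
/-- `gcd(a, p) = p` or `1` for a prime `p`, according as `p ∣ a` or not. [folklore] -/
private theorem gcd_prime_eq {a p : ℕ} (hp : p.Prime) :
    (p ∣ a → a.gcd p = p) ∧ (¬ p ∣ a → a.gcd p = 1) :=
  ⟨fun h ↦ Nat.gcd_eq_right h,
   fun h ↦ by rw [Nat.gcd_comm]; exact (Nat.Prime.coprime_iff_not_dvd hp).mpr h⟩

/-- The `i`-th term of [Aoki1983, Prop. 2.2] at the conductor `d` for a coordinate `x ∈ ℤ/6d`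
(`d` prime to `6`), as evaluated by `IsHodge.rel_sixth_conductor` on the exact level
`M = 6d/gcd(6d, ⟨x⟩)` and unit part `w` of `x`, rewritten as a function of `x`: with `x̃ = x mod d`,
it is `(1 - χ2)(1 - χ3) χ(x̃)⁻¹` for a unit (`M = 6d`), `(1 - χ3) χ(2) χ(x̃)⁻¹` for `x` even,
`3 ∤ x`, prime to `d` (`M = 3d`, `x = 2w`), `2 (1 - χ2) χ(3) χ(x̃)⁻¹` for `x` odd, `3 ∣ x`, prime to `d`
(`M = 2d`, `x = 3w`), `2 χ(6) χ(x̃)⁻¹` for `6 ∣ x` prime to `d` (`M = d`, `x = 6w`), and `0` when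
`x̃` is not a unit. [cite: Aoki1983, Prop. 2.1 and Prop. 2.2 (the terms `L_ψ(αᵢ)`); §9 (III-12) p. 52] -/
private theorem sixth_term (hd2 : ¬ 2 ∣ d) (hd3 : ¬ 3 ∣ d) (hd : d ∣ 6 * d) (h2 : 2 ∣ 6 * d)
    (h3 : 3 ∣ 6 * d) (x : ZMod (6 * d))
    [NeZero (6 * d / (6 * d).gcd x.val)] (w : ZMod (6 * d / (6 * d).gcd x.val))
    (hwx : ((6 * d / (6 * d / (6 * d).gcd x.val) : ℕ) : ZMod (6 * d)) *
      ((w.val : ℕ) : ZMod (6 * d)) = x)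
    (χ : DirichletCharacter ℂ d) :
    (if 6 * d / (6 * d).gcd x.val = 6 * d then
        (1 - χ 2) * (1 - χ 3) * (χ (ZMod.cast w : ZMod d))⁻¹
      else if 6 * d / (6 * d).gcd x.val = 3 * d then (1 - χ 3) * (χ (ZMod.cast w : ZMod d))⁻¹
      else if 6 * d / (6 * d).gcd x.val = 2 * d then 2 * (1 - χ 2) * (χ (ZMod.cast w : ZMod d))⁻¹
      else if 6 * d / (6 * d).gcd x.val = d then 2 * (χ (ZMod.cast w : ZMod d))⁻¹ else 0) =
      if IsUnit x then (1 - χ 2) * (1 - χ 3) * (χ (ZMod.castHom hd (ZMod d) x))⁻¹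
      else if IsUnit (ZMod.castHom hd (ZMod d) x) then
        (if ZMod.castHom h2 (ZMod 2) x = 0 then
          (if ZMod.castHom h3 (ZMod 3) x = 0 then 2 * χ 6 * (χ (ZMod.castHom hd (ZMod d) x))⁻¹
           else (1 - χ 3) * χ 2 * (χ (ZMod.castHom hd (ZMod d) x))⁻¹)
         else 2 * (1 - χ 2) * χ 3 * (χ (ZMod.castHom hd (ZMod d) x))⁻¹)
      else 0 := by
  classical
  have hd0 : d ≠ 0 := NeZero.ne d
  haveI : NeZero (6 * d) := ⟨six_mul_ne_zero' hd0⟩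
  have h6d0 : 0 < 6 * d := Nat.pos_of_ne_zero (six_mul_ne_zero' hd0)
  have hcop2 : Nat.Coprime 2 d := (Nat.Prime.coprime_iff_not_dvd Nat.prime_two).mpr hd2
  have hcop3 : Nat.Coprime 3 d := (Nat.Prime.coprime_iff_not_dvd Nat.prime_three).mpr hd3
  have hcop6 : Nat.Coprime 6 d := by
    rw [show (6 : ℕ) = 2 * 3 by norm_num]; exact Nat.Coprime.mul_left hcop2 hcop3
  set ψ := ZMod.castHom hd (ZMod d) with hψ
  -- the cast of `w` is the residue of `⟨w⟩`
  have hcw : (ZMod.cast w : ZMod d) = ((w.val : ℕ) : ZMod d) := ZMod.cast_eq_val w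
  rw [hcw]
  -- the reductions of `x`
  have hψx : ψ x = ((x.val : ℕ) : ZMod d) := castHom_eq_val_cast hd x
  have hx2 : ZMod.castHom h2 (ZMod 2) x = ((x.val : ℕ) : ZMod 2) := castHom_eq_val_cast h2 x
  have hx3 : ZMod.castHom h3 (ZMod 3) x = ((x.val : ℕ) : ZMod 3) := castHom_eq_val_cast h3 x
  have hgx : (6 * d).gcd x.val = x.val.gcd 2 * x.val.gcd 3 * x.val.gcd d :=
    gcd_six_mul_eq hd2 hd3 x.val
  -- `ψ x` is a unit iff `⟨x⟩` is prime to `d`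
  have hψu : IsUnit (ψ x) ↔ x.val.gcd d = 1 := by
    rw [hψx, ZMod.isUnit_iff_coprime, Nat.coprime_iff_gcd_eq_one]
  -- `w̃` in terms of `x̃`: `k · w̃ = x̃` with `k = 6d/M`
  have hkw : ∀ k : ℕ, 6 * d / (6 * d / (6 * d).gcd x.val) = k →
      ((k : ℕ) : ZMod d) * ((w.val : ℕ) : ZMod d) = ψ x := by
    intro k hk
    have := congrArg ψ hwx
    rwa [map_mul, map_natCast, map_natCast, hk] at this
  have hχinv : ∀ k : ℕ, IsUnit ((k : ℕ) : ZMod d) → 6 * d / (6 * d / (6 * d).gcd x.val) = k →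
      (χ ((w.val : ℕ) : ZMod d))⁻¹ = χ (k : ZMod d) * (χ (ψ x))⁻¹ := by
    intro k hku hk
    have hk' := hkw k hk
    have hχk : χ (k : ZMod d) ≠ 0 := fun h0 ↦ by
      have := DirichletCharacter.unit_norm_eq_one χ hku.unit
      rw [IsUnit.unit_spec, h0, norm_zero] at this
      exact zero_ne_one this
    rw [← hk', map_mul, mul_inv, ← mul_assoc, mul_inv_cancel₀ hχk, one_mul]
  have hunitk : ∀ k : ℕ, k ∣ 6 → IsUnit ((k : ℕ) : ZMod d) := by
    intro k hk
    rw [ZMod.isUnit_iff_coprime]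
    exact Nat.Coprime.coprime_dvd_left hk hcop6
  by_cases hu : IsUnit x
  · -- unit: `g = 1`, `M = 6d`, `w = x`
    have hg1 : (6 * d).gcd x.val = 1 := by
      have h := ZMod.val_coe_unit_coprime hu.unit
      rw [IsUnit.unit_spec] at h
      rw [Nat.gcd_comm]; exact h
    have hM : 6 * d / (6 * d).gcd x.val = 6 * d := by rw [hg1, Nat.div_one]
    have hk : 6 * d / (6 * d / (6 * d).gcd x.val) = 1 := by rw [hM, Nat.div_self h6d0]
    rw [if_pos hM, if_pos hu, hχinv 1 (hunitk 1 (by norm_num)) hk, Nat.cast_one, map_one, one_mul]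
  · by_cases hu' : IsUnit (ψ x)
    · have hgd : x.val.gcd d = 1 := hψu.mp hu'
      rw [if_neg hu, if_pos hu']
      by_cases he : ZMod.castHom h2 (ZMod 2) x = 0
      · have h2x : 2 ∣ x.val := by rw [hx2] at he; exact (ZMod.natCast_eq_zero_iff _ _).mp he
        have hg2 : x.val.gcd 2 = 2 := (gcd_prime_eq Nat.prime_two).1 h2x
        rw [if_pos he]
        by_cases ht : ZMod.castHom h3 (ZMod 3) x = 0
        · -- `6 ∣ x`, prime to `d`: `g = 6`, `M = d`, `x = 6w`
          have h3x : 3 ∣ x.val := by rw [hx3] at ht; exact (ZMod.natCast_eq_zero_iff _ _).mp ht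
          have hg3 : x.val.gcd 3 = 3 := (gcd_prime_eq Nat.prime_three).1 h3x
          have hg6 : (6 * d).gcd x.val = 6 := by rw [hgx, hg2, hg3, hgd]
          have hM : 6 * d / (6 * d).gcd x.val = d := by rw [hg6]; omega
          have hk : 6 * d / (6 * d / (6 * d).gcd x.val) = 6 := by
            rw [hM]; exact Nat.mul_div_cancel 6 (Nat.pos_of_ne_zero hd0)
          have hne6 : d ≠ 6 * d := by omega
          have hne3 : d ≠ 3 * d := by omega
          have hne2 : d ≠ 2 * d := by omega
          rw [if_pos ht, if_neg (by rw [hM]; exact hne6), if_neg (by rw [hM]; exact hne3),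
            if_neg (by rw [hM]; exact hne2), if_pos hM, hχinv 6 (hunitk 6 (by norm_num)) hk,
            Nat.cast_ofNat]
          ring
        · -- even, `3 ∤ x`, prime to `d`: `g = 2`, `M = 3d`, `x = 2w`
          have h3x : ¬ 3 ∣ x.val := by
            rw [hx3] at ht; exact fun h ↦ ht ((ZMod.natCast_eq_zero_iff _ _).mpr h)
          have hg3 : x.val.gcd 3 = 1 := (gcd_prime_eq Nat.prime_three).2 h3x
          have hg2' : (6 * d).gcd x.val = 2 := by rw [hgx, hg2, hg3, hgd]
          have hM : 6 * d / (6 * d).gcd x.val = 3 * d := by rw [hg2']; omega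
          have hk : 6 * d / (6 * d / (6 * d).gcd x.val) = 2 := by
            rw [hM]; exact Nat.div_eq_of_eq_mul_left (by omega) (by ring)
          have hne6 : 3 * d ≠ 6 * d := by omega
          rw [if_neg ht, if_neg (by rw [hM]; exact hne6), if_pos hM, hχinv 2 (hunitk 2 (by norm_num)) hk,
            Nat.cast_ofNat]
          ring
      · -- odd, not a unit, prime to `d`: `3 ∣ x`, `g = 3`, `M = 2d`, `x = 3w`
        have h2x : ¬ 2 ∣ x.val := by
          rw [hx2] at he; exact fun h ↦ he ((ZMod.natCast_eq_zero_iff _ _).mpr h)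
        have hg2 : x.val.gcd 2 = 1 := (gcd_prime_eq Nat.prime_two).2 h2x
        have h3x : 3 ∣ x.val := by
          by_contra h3x
          have hg3 : x.val.gcd 3 = 1 := (gcd_prime_eq Nat.prime_three).2 h3x
          have hg1 : (6 * d).gcd x.val = 1 := by rw [hgx, hg2, hg3, hgd]
          apply hu
          rw [← ZMod.natCast_zmod_val x, ZMod.isUnit_iff_coprime, Nat.coprime_iff_gcd_eq_one,
            Nat.gcd_comm]
          exact hg1
        have hg3 : x.val.gcd 3 = 3 := (gcd_prime_eq Nat.prime_three).1 h3x
        have hg3' : (6 * d).gcd x.val = 3 := by rw [hgx, hg2, hg3, hgd]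
        have hM : 6 * d / (6 * d).gcd x.val = 2 * d := by rw [hg3']; omega
        have hk : 6 * d / (6 * d / (6 * d).gcd x.val) = 3 := by
          rw [hM]; exact Nat.div_eq_of_eq_mul_left (by omega) (by ring)
        have hne6 : 2 * d ≠ 6 * d := by omega
        have hne3 : 2 * d ≠ 3 * d := by omega
        rw [if_neg he, if_neg (by rw [hM]; exact hne6), if_neg (by rw [hM]; exact hne3), if_pos hM,
          hχinv 3 (hunitk 3 (by norm_num)) hk, Nat.cast_ofNat]
        ring
    · -- `x̃` not a unit: the level of `x` is not a multiple of `d`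
      have hgd : x.val.gcd d ≠ 1 := fun h ↦ hu' (hψu.mpr h)
      have hndvd : ∀ t : ℕ, 6 * d / (6 * d).gcd x.val = t * d → False := by
        intro t ht
        have hgdvd : (6 * d).gcd x.val ∣ 6 * d := Nat.gcd_dvd_left _ _
        have hmul : 6 * d / (6 * d).gcd x.val * (6 * d).gcd x.val = 6 * d :=
          Nat.div_mul_cancel hgdvd
        rw [ht] at hmul
        -- `t g = 6`, so `g ∣ 6` and `gcd(⟨x⟩, d) ∣ gcd(g, d) = 1`
        have htg : t * (6 * d).gcd x.val = 6 := by
          have : d * (t * (6 * d).gcd x.val) = d * 6 := by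
            rw [← mul_assoc, mul_comm d t, hmul, mul_comm]
          exact Nat.eq_of_mul_eq_mul_left (Nat.pos_of_ne_zero hd0) this
        have hg6 : (6 * d).gcd x.val ∣ 6 := ⟨t, by rw [mul_comm, htg]⟩
        have hgcop : Nat.Coprime ((6 * d).gcd x.val) d := Nat.Coprime.coprime_dvd_left hg6 hcop6
        have hxd : x.val.gcd d ∣ (6 * d).gcd x.val :=
          Nat.dvd_gcd ((Nat.gcd_dvd_right _ _).trans (dvd_mul_left d 6)) (Nat.gcd_dvd_left _ _)
        have h1 : x.val.gcd d ∣ Nat.gcd ((6 * d).gcd x.val) d :=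
          Nat.dvd_gcd hxd (Nat.gcd_dvd_right _ _)
        rw [hgcop] at h1
        exact hgd (Nat.dvd_one.mp h1)
      rw [if_neg hu, if_neg hu', if_neg (fun h ↦ hndvd 6 h), if_neg (fun h ↦ hndvd 3 h),
        if_neg (fun h ↦ hndvd 2 h), if_neg (fun h ↦ hndvd 1 (by rw [one_mul]; exact h))]

/-- **The Hodge condition at the level `m/6` for `m = 6d`, `d` prime to `6`** ([Aoki1983, Prop. 2.2] at
`f = d`, Aoki's "`τ₆(α) ∈ A(m/6)`", §9 (III-12), (III-13); and the conductor `n/3` for `m = 2n`,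
`3 ∥ n`): for a Hodge character `α : Fin r → ℤ/m` (`m = 6d`) and every odd primitive character `χ` mod
`d`, with `x̃ = x mod d`,
`∑_{αᵢ unit} (1 - conj χ2)(1 - conj χ3) χ(α̃ᵢ) + ∑_{αᵢ even, 3 ∤ αᵢ, prime to d} (1 - conj χ3) conj χ(2) χ(α̃ᵢ)
  + 2 ∑_{αᵢ odd, 3 ∣ αᵢ, prime to d} (1 - conj χ2) conj χ(3) χ(α̃ᵢ) + 2 ∑_{6 ∣ αᵢ, prime to d} conj χ(6) χ(α̃ᵢ)
  = 0`
(coordinates sharing a prime with `d` do not contribute). With `2v₂ = -1`, `3v₃ = -1` in `ℤ/d` the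
four kinds of terms are: `χ(x̃) + χ(v₂x̃) + χ(v₃x̃) + χ(v₂v₃x̃)`, `-χ(v₂x̃) - χ(v₂v₃x̃)`,
`-2χ(v₃x̃) - 2χ(v₂v₃x̃)`, `2χ(v₂v₃x̃)`. The divisibility hypotheses `hd, h2, h3` only name the casts.
[cite: Aoki1983, Prop. 2.2; §9 (III-12)–(III-13) p. 52] -/
theorem IsHodge.rel_sixth_level {m : ℕ} [NeZero m] {r : ℕ} {α : Fin r → ZMod m} (h : IsHodge α)
    (hm : m = 6 * d) (hd2 : ¬ 2 ∣ d) (hd3 : ¬ 3 ∣ d) (hd : d ∣ m) (h2 : 2 ∣ m) (h3 : 3 ∣ m)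
    (χ : DirichletCharacter ℂ d) (hχ : χ.Odd) (hprim : χ.IsPrimitive) :
    ∑ i, (if IsUnit (α i) then
        (1 - starRingEnd ℂ (χ 2)) * (1 - starRingEnd ℂ (χ 3)) * χ (ZMod.castHom hd (ZMod d) (α i))
      else if IsUnit (ZMod.castHom hd (ZMod d) (α i)) then
        (if ZMod.castHom h2 (ZMod 2) (α i) = 0 then
          (if ZMod.castHom h3 (ZMod 3) (α i) = 0 then
              2 * starRingEnd ℂ (χ 6) * χ (ZMod.castHom hd (ZMod d) (α i))
           else (1 - starRingEnd ℂ (χ 3)) * starRingEnd ℂ (χ 2) * χ (ZMod.castHom hd (ZMod d) (α i)))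
         else 2 * (1 - starRingEnd ℂ (χ 2)) * starRingEnd ℂ (χ 3) *
           χ (ZMod.castHom hd (ZMod d) (α i)))
      else 0) = 0 := by
  classical
  subst hm
  have hd0 : d ≠ 0 := NeZero.ne d
  haveI : NeZero (6 * d) := ⟨six_mul_ne_zero' hd0⟩
  set ψ := ZMod.castHom hd (ZMod d) with hψ
  have H := fun i ↦ exists_unit_lift_eq (m := 6 * d) (α i)
  choose w hwu hwx using fun i ↦ (H i).2
  haveI : ∀ i, NeZero (6 * d / (6 * d).gcd (α i).val) := fun i ↦
    ⟨(Nat.div_pos (Nat.le_of_dvd (NeZero.pos (6 * d)) (Nat.gcd_dvd_left _ _))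
      (Nat.gcd_pos_of_pos_left _ (NeZero.pos (6 * d)))).ne'⟩
  -- the levels divisible by `d` are `d, 2d, 3d, 6d`
  have hlev : ∀ i, d ∣ 6 * d / (6 * d).gcd (α i).val →
      6 * d / (6 * d).gcd (α i).val = d ∨ 6 * d / (6 * d).gcd (α i).val = 2 * d ∨
      6 * d / (6 * d).gcd (α i).val = 3 * d ∨ 6 * d / (6 * d).gcd (α i).val = 6 * d := by
    intro i hdi
    obtain ⟨t, ht⟩ := hdi
    have hM6 : 6 * d / (6 * d).gcd (α i).val ∣ 6 * d := (H i).1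
    rw [ht] at hM6 ⊢
    have ht6 : t ∣ 6 := by
      obtain ⟨s, hs⟩ := hM6
      refine ⟨s, Nat.eq_of_mul_eq_mul_left (Nat.pos_of_ne_zero hd0) ?_⟩
      have : d * (t * s) = 6 * d := by rw [← mul_assoc, ← hs]
      rw [this, mul_comm]
    have ht6' : t ≤ 6 := Nat.le_of_dvd (by norm_num) ht6
    have ht0 : 0 < t := Nat.pos_of_ne_zero (by rintro rfl; simp at ht6)
    interval_cases t <;> omega
  have key := h.rel_sixth_conductor hd2 hd3 hd hχ hprim
    (fun i ↦ 6 * d / (6 * d).gcd (α i).val) (fun i ↦ (H i).1) w hwu (fun i ↦ (hwx i).symm)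
    (fun i hdi ↦ by
      rcases hlev i hdi with h1 | h2' | h3' | h6'
      · exact Or.inl h1
      · exact Or.inr (Or.inl h2')
      · exact Or.inr (Or.inr (Or.inl h3'))
      · exact Or.inr (Or.inr (Or.inr h6')))
  have key' : ∑ i, (if IsUnit (α i) then (1 - χ 2) * (1 - χ 3) * (χ (ψ (α i)))⁻¹
      else if IsUnit (ψ (α i)) then
        (if ZMod.castHom h2 (ZMod 2) (α i) = 0 then
          (if ZMod.castHom h3 (ZMod 3) (α i) = 0 then 2 * χ 6 * (χ (ψ (α i)))⁻¹
           else (1 - χ 3) * χ 2 * (χ (ψ (α i)))⁻¹)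
         else 2 * (1 - χ 2) * χ 3 * (χ (ψ (α i)))⁻¹)
      else 0) = 0 := by
    rw [Finset.sum_congr rfl fun i _ ↦ (sixth_term hd2 hd3 hd h2 h3 (α i) (w i) (hwx i) χ).symm]
    exact key
  -- conjugate: `(χ y)⁻¹ = conj (χ y)` and `χ k = conj (conj χ k)`
  have hinv : ∀ y : ZMod d, (χ y)⁻¹ = starRingEnd ℂ (χ y) := by
    intro y
    by_cases hy : IsUnit y
    · exact Complex.inv_eq_conj (χ.unit_norm_eq_one hy.unit ▸ by rw [IsUnit.unit_spec])
    · rw [χ.map_nonunit hy, inv_zero, map_zero]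
  have c2 : starRingEnd ℂ (2 : ℂ) = 2 := map_ofNat _ 2
  have cc : ∀ y : ZMod d, starRingEnd ℂ (starRingEnd ℂ (χ y)) = χ y := fun y ↦ Complex.conj_conj _
  have hterm : ∀ i, (if IsUnit (α i) then
        (1 - starRingEnd ℂ (χ 2)) * (1 - starRingEnd ℂ (χ 3)) * χ (ψ (α i))
      else if IsUnit (ψ (α i)) then
        (if ZMod.castHom h2 (ZMod 2) (α i) = 0 then
          (if ZMod.castHom h3 (ZMod 3) (α i) = 0 then 2 * starRingEnd ℂ (χ 6) * χ (ψ (α i))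
           else (1 - starRingEnd ℂ (χ 3)) * starRingEnd ℂ (χ 2) * χ (ψ (α i)))
         else 2 * (1 - starRingEnd ℂ (χ 2)) * starRingEnd ℂ (χ 3) * χ (ψ (α i)))
      else 0) =
      starRingEnd ℂ (if IsUnit (α i) then (1 - χ 2) * (1 - χ 3) * (χ (ψ (α i)))⁻¹
      else if IsUnit (ψ (α i)) then
        (if ZMod.castHom h2 (ZMod 2) (α i) = 0 then
          (if ZMod.castHom h3 (ZMod 3) (α i) = 0 then 2 * χ 6 * (χ (ψ (α i)))⁻¹
           else (1 - χ 3) * χ 2 * (χ (ψ (α i)))⁻¹)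
         else 2 * (1 - χ 2) * χ 3 * (χ (ψ (α i)))⁻¹)
      else 0) := by
    intro i
    by_cases hu : IsUnit (α i)
    · rw [if_pos hu, if_pos hu, map_mul, map_mul, map_sub, map_sub, map_one, map_inv₀,
        ← hinv (ψ (α i)), inv_inv]
    · rw [if_neg hu, if_neg hu]
      by_cases hu' : IsUnit (ψ (α i))
      · rw [if_pos hu', if_pos hu']
        by_cases he : ZMod.castHom h2 (ZMod 2) (α i) = 0
        · rw [if_pos he, if_pos he]
          by_cases ht : ZMod.castHom h3 (ZMod 3) (α i) = 0
          · rw [if_pos ht, if_pos ht, map_mul, map_mul, c2, map_inv₀, ← hinv (ψ (α i)), inv_inv]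
          · rw [if_neg ht, if_neg ht, map_mul, map_mul, map_sub, map_one, map_inv₀, ← hinv (ψ (α i)),
              inv_inv]
        · rw [if_neg he, if_neg he, map_mul, map_mul, map_mul, c2, map_sub, map_one, map_inv₀,
            ← hinv (ψ (α i)), inv_inv]
      · rw [if_neg hu', if_neg hu', map_zero]
  rw [Finset.sum_congr rfl fun i _ ↦ hterm i, ← map_sum, key', map_zero]

end SixthLevel

end FermatCharacter

end Literature.AlgebraicGeometry.HodgeTheory
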